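import Literature.NumberTheory.Automorphic.CuspidalTransposeInv
import Literature.NumberTheory.Automorphic.LocalComponentBJ
import Literature.NumberTheory.Automorphic.RankinSelbergLocalEquiv
import HarnessLib

/-!
# Local components of the transpose-inverse twist `π^τ`: `(π^τ)_v = π_v ∘ τ_v`

Topic `Literature/NumberTheory/Automorphic`; proof file (theorems only).  For a Borel–Jacquet
datum `π = W / W'` on `GL_n(𝔸_K)` and its transpose-inverse twist `π^τ = (W ∘ τ, W' ∘ τ)`
(`AutomorphicRepData.transposeInv`, `τ(g) = w₀ ᵗg⁻¹ w₀`), a local component `ρ` of `π` at a finite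
place `v` (`AutomorphicRepData.HasLocalComponentAt`: a non-zero `GL_n(K_v)`-map `V_ρ → W / W'`
along `GLn.ofLocal`) gives the local component `ρ ∘ τ_v` of `π^τ` at `v`, `τ_v(g) = w₀ ᵗg⁻¹ w₀` the
same automorphism of `GL_n(K_v)`: compose the local map with `φ ↦ φ ∘ τ` and use
`GLn.ofLocal (τ_v g) = τ (GLn.ofLocal g)` (`GLn.ofLocal_conj_glTransposeInv`).  Since `τ` is an
involution this is an `iff` (`hasLocalComponentAt_transposeInv_iff`).  Locally `ρ ∘ τ_v ≅ ρ ∘ ι`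
for the plain transpose-inverse `ι(g) = ᵗg⁻¹` (intertwined by `ρ(w₀)`,
`nonempty_equiv_comp_conj_glTransposeInv`), so the Rankin–Selberg `L`-polynomials and Satake
parameters of `(π^τ)_v` are those of `π_v ∘ ι` (`hasRSLFactor_comp_conj_glTransposeInv_iff`,
`isSatakeParameter_comp_conj_glTransposeInv_iff`) — the dictionary feeding the dual side
`L(s, π^τ_u)`, `ε(s, π_u × χ, ψ)` (`GL2LocalEpsilonFactor`, stated for `π_u ∘ ι`) of the functional
equation of the standard `L`-function (`StandardLTheoryGL2AnalyticAssembly`, hypothesis `hP'`).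
(Jacquet–Langlands 1970, proof of Thm. 11.1: "`φ ↦ φ(ᵗg⁻¹)` realises `π̃ = ⊗ π̃_v`"; Cogdell 2004, §1.)

## References

* H. Jacquet, R. P. Langlands, *Automorphic Forms on GL(2)*, LNM 114 (1970), proof of Thm. 11.1.
  [JacquetLanglands1970]
* J. W. Cogdell, *Lectures on L-functions, converse theorems, and functoriality for GLₙ*, Fields
  Inst. Monogr. 20 (2004), §1. [CogdellAnalyticTheory2004]
* D. Flath, *Decomposition of representations into tensor products*, Corvallis 1979, Thm. 3–4.
  [FlathCorvallis1979]
-/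

noncomputable section

open scoped MatrixGroups Matrix NNReal Classical
open NumberField IsDedekindDomain Polynomial MeasureTheory

namespace Literature.NumberTheory.Automorphic

open GaloisRepresentations (glTransposeInv coe_glTransposeInv_apply)

/-! ### The local automorphism `τ_v = w₀ ᵗ(·)⁻¹ w₀` and the local embedding -/

section Local

variable {n : ℕ} {R : Type*} [CommRing R] [TopologicalSpace R]

/-- `(w₀ ᵗ(·)⁻¹ w₀⁻¹) g = w₀ ᵗg⁻¹ w₀` (`w₀⁻¹ = w₀`): the conjugate of the transpose-inverse by the
long Weyl element, as a monoid homomorphism, is the tree's `τ`. [folklore] -/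
theorem conj_glTransposeInv_apply (g : GL (Fin n) R) :
    ((MulAut.conj (weylLong n R)).toMonoidHom.comp (glTransposeInv (Fin n) R).toMonoidHom) g =
      weylLong n R * glTransposeInv (Fin n) R g * weylLong n R := by
  rw [MonoidHom.comp_apply, MulEquiv.coe_toMonoidHom, MulAut.conj_apply, weylLong_inv]
  rfl

variable {V : Type*} [AddCommGroup V] [Module ℂ V]

/-- **`ρ ∘ τ ≅ ρ ∘ ι`**: `ρ(w₀)` intertwines `ρ ∘ (w₀ ᵗ(·)⁻¹ w₀)` with `ρ ∘ ᵗ(·)⁻¹`. [folklore] -/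
theorem nonempty_equiv_comp_conj_glTransposeInv (ρ : Representation ℂ (GL (Fin n) R) V) :
    Nonempty (Representation.Equiv (ρ.comp ((MulAut.conj (weylLong n R)).toMonoidHom.comp
      (glTransposeInv (Fin n) R).toMonoidHom)) (ρ.comp (glTransposeInv (Fin n) R).toMonoidHom)) := by
  have hw : ρ (weylLong n R) ∘ₗ ρ (weylLong n R) = LinearMap.id := by
    rw [← Module.End.mul_eq_comp, ← map_mul, weylLong_mul_self, map_one]; rfl
  refine ⟨Representation.Equiv.mk (LinearEquiv.ofLinear (ρ (weylLong n R)) (ρ (weylLong n R)) hw hw)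
    fun g => ?_⟩
  change ρ (weylLong n R) ∘ₗ ρ (((MulAut.conj (weylLong n R)).toMonoidHom.comp
      (glTransposeInv (Fin n) R).toMonoidHom) g) =
    ρ ((glTransposeInv (Fin n) R).toMonoidHom g) ∘ₗ ρ (weylLong n R)
  rw [conj_glTransposeInv_apply, ← Module.End.mul_eq_comp, ← Module.End.mul_eq_comp, ← map_mul,
    ← map_mul, ← mul_assoc, ← mul_assoc, weylLong_mul_self, one_mul]
  rfl

end Local

/-! ### Rankin–Selberg data of `ρ ∘ τ` versus `ρ ∘ ι` -/

section RS

variable {F : Type*} [Field F] [ValuativeRel F] [TopologicalSpace F] [IsNonarchimedeanLocalField F]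
  {V : Type*} [AddCommGroup V] [Module ℂ V]

/-- The Satake parameters of `ρ ∘ τ` are those of `ρ ∘ ι`. [folklore] -/
theorem isSatakeParameter_comp_conj_glTransposeInv_iff {n : ℕ} (ρ : Representation ℂ (GL (Fin n) F) V)
    (ϖ : Fˣ) (α : Multiset ℂ) :
    IsSatakeParameter (ρ.comp ((MulAut.conj (weylLong n F)).toMonoidHom.comp
      (glTransposeInv (Fin n) F).toMonoidHom)) ϖ α ↔
    IsSatakeParameter (ρ.comp (glTransposeInv (Fin n) F).toMonoidHom) ϖ α := by
  obtain ⟨e⟩ := nonempty_equiv_comp_conj_glTransposeInv ρ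
  exact isSatakeParameter_iff_of_equiv e ϖ α

variable {m n : ℕ} (hmn : m < n) [MeasurableSpace F] [BorelSpace F]
  [MeasurableSpace (GL (Fin m) F ⧸ upperUnitriangular (Fin m) F)]
  [BorelSpace (GL (Fin m) F ⧸ upperUnitriangular (Fin m) F)]
  {V' : Type*} [AddCommGroup V'] [Module ℂ V']

omit [MeasurableSpace F] [BorelSpace F] [BorelSpace (GL (Fin m) F ⧸ upperUnitriangular (Fin m) F)] in
/-- **The `L`-polynomials of `ρ ∘ τ` are those of `ρ ∘ ι`** (`HasRSLFactor` is an isomorphism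
invariant, `hasRSLFactor_iff_of_equiv_left`). [folklore] -/
theorem hasRSLFactor_comp_conj_glTransposeInv_iff (ρ : Representation ℂ (GL (Fin n) F) V)
    (π' : Representation ℂ (GL (Fin m) F) V') (ψ : AddChar F Circle)
    (ν : Measure (GL (Fin m) F ⧸ upperUnitriangular (Fin m) F)) (P : ℂ[X]) :
    HasRSLFactor hmn (ρ.comp ((MulAut.conj (weylLong n F)).toMonoidHom.comp
      (glTransposeInv (Fin n) F).toMonoidHom)) π' ψ ν P ↔
    HasRSLFactor hmn (ρ.comp (glTransposeInv (Fin n) F).toMonoidHom) π' ψ ν P := by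
  obtain ⟨e⟩ := nonempty_equiv_comp_conj_glTransposeInv ρ
  exact hasRSLFactor_iff_of_equiv_left e P

omit [BorelSpace F] [BorelSpace (GL (Fin m) F ⧸ upperUnitriangular (Fin m) F)] in
/-- The `γ`-factors of `ρ ∘ τ` are those of `ρ ∘ ι`. [folklore] -/
theorem hasRSGamma_comp_conj_glTransposeInv_iff (ρ : Representation ℂ (GL (Fin n) F) V)
    (π' : Representation ℂ (GL (Fin m) F) V') (ψ : AddChar F Circle) (μ : Measure F)
    (ν : Measure (GL (Fin m) F ⧸ upperUnitriangular (Fin m) F)) (γ : RatFunc ℂ) :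
    HasRSGamma hmn (ρ.comp ((MulAut.conj (weylLong n F)).toMonoidHom.comp
      (glTransposeInv (Fin n) F).toMonoidHom)) π' ψ μ ν γ ↔
    HasRSGamma hmn (ρ.comp (glTransposeInv (Fin n) F).toMonoidHom) π' ψ μ ν γ := by
  obtain ⟨e⟩ := nonempty_equiv_comp_conj_glTransposeInv ρ
  exact hasRSGamma_iff_of_equiv_left e γ

end RS

/-! ### Local components of `π^τ` -/

section Global

variable {n : ℕ} {K : Type} [Field K] [NumberField K] {hcpt : isCompact_glFiniteIntegralLevel n K}

/-- **The local embedding commutes with `τ`**: `GLn.ofLocal (w₀ ᵗg⁻¹ w₀) = τ (GLn.ofLocal g)`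
(`τ` of the identity matrix at the other places is the identity). [folklore] -/
theorem GLn.ofLocal_conj_glTransposeInv (v : HeightOneSpectrum (𝓞 K))
    (g : GL (Fin n) (v.adicCompletion K)) :
    GLn.ofLocal n K v (weylLong n (v.adicCompletion K) * glTransposeInv (Fin n) (v.adicCompletion K) g *
      weylLong n (v.adicCompletion K)) =
    (weylLong n (AdeleRing (𝓞 K) K) * glTransposeInv (Fin n) (AdeleRing (𝓞 K) K) (GLn.ofLocal n K v g) *
      weylLong n (AdeleRing (𝓞 K) K)) := by
  refine Matrix.GeneralLinearGroup.ext fun i j => ?_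
  rw [GLn.coe_ofLocal_apply, coe_weylLong_mul_glTransposeInv_mul_weylLong_apply,
    coe_weylLong_mul_glTransposeInv_mul_weylLong_apply, ← map_inv, GLn.coe_ofLocal_apply]
  simp only [Matrix.one_apply, Fin.rev_inj, eq_comm]

/-- **A local component of `π` gives the local component `ρ ∘ τ_v` of `π^τ`**
(Jacquet–Langlands 1970, proof of Thm. 11.1; Cogdell 2004, §1): compose the local map
`f : V_ρ → W` with `φ ↦ φ ∘ τ`. [cite: JacquetLanglands1970, Thm. 11.1 (proof)] -/
theorem AutomorphicRepData.HasLocalComponentAt.transposeInv {π : AutomorphicRepData (AutomorphyDatum.gl n K hcpt)}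
    {v : HeightOneSpectrum (𝓞 K)} {V : Type*} [AddCommGroup V] [Module ℂ V]
    {ρ : Representation ℂ (GL (Fin n) (v.adicCompletion K)) V} (h : π.HasLocalComponentAt v ρ) :
    π.transposeInv.HasLocalComponentAt v
      (ρ.comp ((MulAut.conj (weylLong n (v.adicCompletion K))).toMonoidHom.comp
        (glTransposeInv (Fin n) (v.adicCompletion K)).toMonoidHom)) := by
  obtain ⟨f, hW, hW', hf⟩ := h
  refine ⟨(LinearMap.funLeft ℂ ℂ (m := (AdelicGroupData.gl n K).Adelic)
      (n := (AdelicGroupData.gl n K).Adelic) fun g => weylLong n (AdeleRing (𝓞 K) K) *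
        glTransposeInv (Fin n) (AdeleRing (𝓞 K) K) g * weylLong n (AdeleRing (𝓞 K) K)) ∘ₗ f,
    ?_, ?_, fun g x => ?_⟩
  · rw [LinearMap.range_comp, AutomorphicRepData.transposeInv_W]
    exact Submodule.map_mono hW
  · intro h'
    apply hW'
    rw [LinearMap.range_comp, AutomorphicRepData.transposeInv_W',
      map_funLeft_weylLong_mul_glTransposeInv_mul_weylLong_le_iff,
      map_funLeft_map_funLeft_weylLong_mul_glTransposeInv_mul_weylLong] at h'
    exact h'
  · rw [AutomorphicRepData.transposeInv_W', LinearMap.comp_apply, LinearMap.comp_apply,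
      rightTranslation_funLeft_weylLong_mul_glTransposeInv_mul_weylLong,
      ← GLn.ofLocal_conj_glTransposeInv, ← map_sub]
    refine Submodule.mem_map_of_mem ?_
    have := hf (weylLong n (v.adicCompletion K) * glTransposeInv (Fin n) (v.adicCompletion K) g *
      weylLong n (v.adicCompletion K)) x
    rwa [← conj_glTransposeInv_apply] at this

/-- **Local components of `π^τ` are exactly the `ρ ∘ τ_v`** for local components `ρ` of `π`
(`τ` is an involution on data and on representations). [folklore] -/
theorem AutomorphicRepData.hasLocalComponentAt_transposeInv_iff (π : AutomorphicRepData (AutomorphyDatum.gl n K hcpt))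
    (v : HeightOneSpectrum (𝓞 K)) {V : Type*} [AddCommGroup V] [Module ℂ V]
    (ρ : Representation ℂ (GL (Fin n) (v.adicCompletion K)) V) :
    π.transposeInv.HasLocalComponentAt v ρ ↔
      π.HasLocalComponentAt v
        (ρ.comp ((MulAut.conj (weylLong n (v.adicCompletion K))).toMonoidHom.comp
          (glTransposeInv (Fin n) (v.adicCompletion K)).toMonoidHom)) := by
  set τv : GL (Fin n) (v.adicCompletion K) →* GL (Fin n) (v.adicCompletion K) :=
    (MulAut.conj (weylLong n (v.adicCompletion K))).toMonoidHom.comp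
      (glTransposeInv (Fin n) (v.adicCompletion K)).toMonoidHom with hτv
  have hinv : τv.comp τv = MonoidHom.id _ := by
    ext1 g
    rw [MonoidHom.comp_apply, MonoidHom.id_apply, hτv, conj_glTransposeInv_apply,
      conj_glTransposeInv_apply, weylLong_mul_glTransposeInv_mul_weylLong_involutive]
  have hρ : (ρ.comp τv).comp τv = ρ := by
    rw [MonoidHom.comp_assoc, hinv, MonoidHom.comp_id]
  constructor
  · intro h
    have h2 := AutomorphicRepData.HasLocalComponentAt.transposeInv h
    rwa [AutomorphicRepData.transposeInv_transposeInv] at h2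
  · intro h
    have h2 := AutomorphicRepData.HasLocalComponentAt.transposeInv h
    rwa [← hτv, hρ] at h2

/-- **Cuspidal version**: a local component `ρ` of a cuspidal `π` on `GL_n(𝔸_K)` gives the local
component `ρ ∘ τ_v` of the cuspidal `π^τ` (`CuspidalAutomorphicRepData.transposeInv`).
[cite: JacquetLanglands1970, Thm. 11.1 (proof)] -/
theorem CuspidalAutomorphicRepData.hasLocalComponentAt_transposeInv
    (π : CuspidalAutomorphicRepData n K hcpt) {v : HeightOneSpectrum (𝓞 K)}
    {V : Type*} [AddCommGroup V] [Module ℂ V]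
    {ρ : Representation ℂ (GL (Fin n) (v.adicCompletion K)) V} (h : π.1.HasLocalComponentAt v ρ) :
    π.transposeInv.1.HasLocalComponentAt v
      (ρ.comp ((MulAut.conj (weylLong n (v.adicCompletion K))).toMonoidHom.comp
        (glTransposeInv (Fin n) (v.adicCompletion K)).toMonoidHom)) := by
  rw [CuspidalAutomorphicRepData.transposeInv_val]
  exact AutomorphicRepData.HasLocalComponentAt.transposeInv h

/-- Cuspidal `iff` version of `hasLocalComponentAt_transposeInv_iff`. [folklore] -/
theorem CuspidalAutomorphicRepData.hasLocalComponentAt_transposeInv_iff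
    (π : CuspidalAutomorphicRepData n K hcpt) (v : HeightOneSpectrum (𝓞 K))
    {V : Type*} [AddCommGroup V] [Module ℂ V]
    (ρ : Representation ℂ (GL (Fin n) (v.adicCompletion K)) V) :
    π.transposeInv.1.HasLocalComponentAt v ρ ↔
      π.1.HasLocalComponentAt v
        (ρ.comp ((MulAut.conj (weylLong n (v.adicCompletion K))).toMonoidHom.comp
          (glTransposeInv (Fin n) (v.adicCompletion K)).toMonoidHom)) := by
  rw [CuspidalAutomorphicRepData.transposeInv_val]
  exact AutomorphicRepData.hasLocalComponentAt_transposeInv_iff π.1 v ρ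

end Global

end Literature.NumberTheory.Automorphic

end
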